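import Literature.NumberTheory.Automorphic.ModularLambdaAlgebraic
import HarnessLib

/-!
# The orbit polynomial of a modular function over `ℂ(λ)`

Sequel of `ModularLambdaAlgebraic.lean` (Calegari–Dimitrov–Tang, *The unbounded denominators
conjecture*, J. Amer. Math. Soc. **38** (2025), arXiv:2109.09040, §1 p. 3: a modular function for
a finite-index subgroup of `SL(2, ℤ)` "is an algebraic function of `λ`, with branching only at the
three punctures `λ = 0, 1, ∞`"). For the analytic proof of the Galois-conjugation input of
Remark 59 we need the algebraic equation of a modular function over `ℂ(λ)` together with the
COMPLETE list of its roots as holomorphic functions on `ℍ`: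

* `exists_conjugate_finset` — for `G : ℍ → ℂ` invariant under a normal finite-index
  `Γ₀ ≤ SL(2, ℤ)`, the conjugates `z ↦ G(A • z)`, `A ∈ SL(2, ℤ)`, form a finite set `T`;
* **`exists_orbitPolynomial`** — for a finite set `O` of holomorphic functions on `ℍ` of
  exponential type `k` at every cusp which is stable under `Φ ↦ Φ ∘ γ` (`γ ∈ Γ(2)`), there is a
  polynomial `𝒫 ∈ ℂ[X][Y]` of `Y`-degree `#O` with top coefficient `(X(1−X))^{k·#O}` such that
  for every `τ ∈ ℍ`
  `𝒫(λ(τ), Y) = (λ(τ)(1 − λ(τ)))^{k·#O} · ∏_{Φ ∈ O} (Y − Φ(τ))`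
  (the coefficients of `∏ (Y − Φ(τ))` are `Γ(2)`-invariant holomorphic functions of exponential
  type `k·#O` at the three cusps, hence Laurent polynomials in `λ` by
  `exists_polynomial_of_Gamma_two_invariant_of_forall`);
* `orbitPolynomial_coeff_comp_one_sub` — if `Φ ↦ Φ ∘ S` maps `O` into `O'` (`#O = #O'`), then
  `𝒫_O(1 − X, Y) = 𝒫_{O'}(X, Y)` (`λ(S • τ) = 1 − λ(τ)`);
* `orbitPolynomial_coeff_eq_of_eval_eq` — the coefficients of `𝒫` are determined by the
  displayed identity (`λ(ℍ)` is infinite).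

No definitions, no named facts.

## References

* [CalegariDimitrovTang2025] arXiv:2109.09040, §1 p. 3; §3, proof of Proposition 15; Remark 59.
* G. Shimura, *Introduction to the Arithmetic Theory of Automorphic Functions* (1971), §2.1.
-/

noncomputable section

open Complex Filter Topology Function Metric Set Polynomial
open UpperHalfPlane hiding I
open scoped Real Topology MatrixGroups Modular Manifold

namespace Literature.NumberTheory.Automorphic

namespace ModularLambda

open Literature.NumberTheory.EllipticCurves.JacobiThetaNull
open ModularGroup Matrix.SpecialLinearGroup

/-! ### The finite set of conjugates of a modular function -/

/-- **The conjugates of a function invariant under a normal finite-index subgroup form a finite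
set.** For `G : ℍ → ℂ` invariant under a normal finite-index `Γ₀ ≤ SL(2, ℤ)`, the functions
`z ↦ G(A • z)` (`A ∈ SL(2, ℤ)`) depend only on the coset of `A`, so there are finitely many of
them. [folklore] -/
theorem exists_conjugate_finset {Γ₀ : Subgroup SL(2, ℤ)} [Γ₀.FiniteIndex] [Γ₀.Normal]
    (G : ℍ → ℂ) (hG : ∀ γ ∈ Γ₀, ∀ z : ℍ, G (γ • z) = G z) :
    ∃ T : Finset (ℍ → ℂ), (∀ Φ ∈ T, ∃ A : SL(2, ℤ), Φ = fun z ↦ G (A • z)) ∧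
      ∀ A : SL(2, ℤ), (fun z ↦ G (A • z)) ∈ T := by
  classical
  set c : SL(2, ℤ) → ℍ → ℂ := fun A z ↦ G (A • z) with hc
  set c' : SL(2, ℤ) ⧸ Γ₀ → ℍ → ℂ := fun q ↦ c q.out with hc'
  haveI : Finite (SL(2, ℤ) ⧸ Γ₀) := Subgroup.finite_quotient_of_finiteIndex
  have hcc' : ∀ A : SL(2, ℤ), c A = c' (QuotientGroup.mk A) := by
    intro A
    obtain ⟨γ, hγ⟩ := QuotientGroup.mk_out_eq_mul (s := Γ₀) A
    funext z
    simp only [hc', hc, hγ]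
    -- `A γ = (A γ A⁻¹) A` with `A γ A⁻¹ ∈ Γ₀`
    have hmem : A * (γ : SL(2, ℤ)) * A⁻¹ ∈ Γ₀ := Subgroup.Normal.conj_mem inferInstance _ γ.2 A
    have : (A * (γ : SL(2, ℤ))) • z = (A * (γ : SL(2, ℤ)) * A⁻¹) • A • z := by
      rw [← mul_smul, inv_mul_cancel_right]
    rw [this, hG _ hmem]
  refine ⟨(Set.finite_range c').toFinset, fun Φ hΦ ↦ ?_, fun A ↦ ?_⟩
  · rw [Set.Finite.mem_toFinset, Set.mem_range] at hΦ
    obtain ⟨q, rfl⟩ := hΦ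
    exact ⟨q.out, rfl⟩
  · rw [Set.Finite.mem_toFinset, Set.mem_range]
    exact ⟨QuotientGroup.mk A, (hcc' A).symm⟩

/-- Precomposition with `γ` is injective on functions on `ℍ`. [folklore] -/
theorem comp_smul_injective (γ : SL(2, ℤ)) {Φ Ψ : ℍ → ℂ}
    (h : (fun z ↦ Φ (γ • z)) = fun z ↦ Ψ (γ • z)) : Φ = Ψ := by
  funext z
  have := congrFun h (γ⁻¹ • z)
  simpa using this

/-! ### The orbit polynomial -/

/-- **The orbit polynomial.** Let `O` be a finite set of holomorphic functions on `ℍ` of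
exponential type `k` at every cusp (`‖Φ(g • z)‖ ≤ M e^{πk Im z}` high up, all `g ∈ SL(2, ℤ)`),
stable under `Φ ↦ Φ ∘ γ` for `γ ∈ Γ(2)`. Then there is `𝒫 ∈ ℂ[X][Y]` with `Y`-degree `#O`, top
coefficient `(X(1 − X))^{k·#O}` and coefficients of `X`-degree `≤ 3k·#O`, such that
`𝒫(λ(τ), Y) = (λ(τ)(1 − λ(τ)))^{k·#O} ∏_{Φ ∈ O} (Y − Φ(τ))` for all `τ ∈ ℍ`.
[cite: CalegariDimitrovTang2025, §1 p. 3 and Remark 59] -/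
theorem exists_orbitPolynomial (k : ℕ) (O : Finset (ℍ → ℂ))
    (hd : ∀ Φ ∈ O, MDiff Φ)
    (hg : ∀ Φ ∈ O, ∀ g : SL(2, ℤ), ∃ B M : ℝ, ∀ z : ℍ, B ≤ z.im →
      ‖Φ (g • z)‖ ≤ M * Real.exp (π * k * z.im))
    (hO : ∀ γ ∈ CongruenceSubgroup.Gamma 2, ∀ Φ ∈ O, (fun z ↦ Φ (γ • z)) ∈ O) :
    ∃ Porb : Polynomial ℂ[X], Porb.natDegree ≤ O.card ∧
      Porb.coeff O.card = (X * (1 - X)) ^ (k * O.card) ∧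
      (∀ n, (Porb.coeff n).natDegree ≤ 3 * (k * O.card)) ∧
      ∀ τ : ℍ, Porb.map (evalRingHom (modularLambda τ)) =
        C ((modularLambda τ * (1 - modularLambda τ)) ^ (k * O.card)) *
          ∏ Φ ∈ O, (X - C (Φ τ)) := by
  classical
  set d : ℕ := O.card with hdcard
  -- the pointwise polynomial and its coefficient functions (on `ℂ`, through `ofComplex`)
  set P : ℂ → ℂ[X] := fun τ ↦ ∏ Φ ∈ O, (X - C (Φ (ofComplex τ))) with hP
  have hPH : ∀ z : ℍ, P z = ∏ Φ ∈ O, (X - C (Φ z)) := fun z ↦ by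
    simp only [hP, ofComplex_apply]
  have hPdeg : ∀ τ, (P τ).natDegree = d := fun τ ↦ by
    rw [hP, natDegree_finsetProd_X_sub_C_eq_card]
  have hPtop : ∀ τ, (P τ).coeff d = 1 := fun τ ↦ by
    have h := (monic_prod_X_sub_C (fun Φ ↦ Φ (ofComplex τ)) O).coeff_natDegree
    rwa [hPdeg] at h
  -- `Γ(2)` permutes `O`, so `P` is `Γ(2)`-invariant
  have hPinv : ∀ γ ∈ CongruenceSubgroup.Gamma 2, ∀ z : ℍ, P ((γ • z : ℍ) : ℂ) = P z := by
    intro γ hγ z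
    rw [hPH, hPH]
    -- reindex the product along the bijection `Φ ↦ Φ ∘ γ` of `O`
    have hinj : Set.InjOn (fun Φ : ℍ → ℂ ↦ fun w ↦ Φ (γ • w)) O :=
      fun Φ _ Ψ _ h ↦ comp_smul_injective γ h
    have himage : O.image (fun Φ : ℍ → ℂ ↦ fun w ↦ Φ (γ • w)) = O := by
      apply Finset.eq_of_subset_of_card_le
      · intro Ψ hΨ
        rw [Finset.mem_image] at hΨ
        obtain ⟨Φ, hΦ, rfl⟩ := hΨ
        exact hO γ hγ Φ hΦ
      · rw [Finset.card_image_of_injOn hinj]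
    calc ∏ Φ ∈ O, (X - C (Φ (γ • z)))
        = ∏ Ψ ∈ O.image (fun Φ : ℍ → ℂ ↦ fun w ↦ Φ (γ • w)), (X - C (Ψ z)) := by
          rw [Finset.prod_image hinj]
      _ = ∏ Φ ∈ O, (X - C (Φ z)) := by rw [himage]
  have hainv : ∀ n, ∀ γ ∈ CongruenceSubgroup.Gamma 2, ∀ z : ℍ,
      (P ((γ • z : ℍ) : ℂ)).coeff n = (P z).coeff n := fun n γ hγ z ↦ by rw [hPinv γ hγ z]
  -- holomorphy of the coefficient functions
  have hOd : ∀ Φ ∈ O, DifferentiableOn ℂ (fun τ : ℂ ↦ Φ (ofComplex τ)) {z : ℂ | 0 < z.im} :=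
    fun Φ hΦ ↦ UpperHalfPlane.mdifferentiable_iff.mp (hd Φ hΦ)
  have had : ∀ n, DifferentiableOn ℂ (fun τ ↦ (P τ).coeff n) {z : ℂ | 0 < z.im} := by
    intro n
    have h := differentiableOn_coeff_prod_X_sub_C (ι := O)
      (f := fun Φ τ ↦ (Φ : ℍ → ℂ) (ofComplex τ)) (U := {z : ℂ | 0 < z.im}) (fun Φ ↦ hOd Φ Φ.2)
      Finset.univ n
    have hfun : (fun τ ↦ (P τ).coeff n) =
        fun τ ↦ (∏ q : O, (X - C ((q : ℍ → ℂ) (ofComplex τ)))).coeff n := by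
      funext τ
      simp only [hP]
      congr 1
      exact (Finset.prod_coe_sort O _).symm
    rw [hfun]
    exact h
  -- growth of the coefficient functions at every cusp
  have hgrow : ∀ g₀ : SL(2, ℤ), ∃ B M : ℝ, ∀ (n : ℕ) (z : ℍ), B ≤ z.im →
      ‖(P ((g₀ • z : ℍ) : ℂ)).coeff n‖ ≤ M * Real.exp (π * (k * d : ℕ) * z.im) := by
    intro g₀
    obtain ⟨B, M, -, h⟩ := norm_coeff_prod_X_sub_C_le k
      (f := fun (Φ : O) (z : ℍ) ↦ (Φ : ℍ → ℂ) (g₀ • z)) (fun Φ ↦ hg Φ Φ.2 g₀) Finset.univ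
    refine ⟨B, M, fun n z hz ↦ ?_⟩
    have := h n z hz
    rw [Finset.card_univ, Fintype.card_coe] at this
    rw [hPH, ← Finset.prod_coe_sort O]
    convert this using 3
    push_cast
    ring
  have hgr : ∀ n, ∀ g₀ : SL(2, ℤ), ∃ B M : ℝ, ∀ z : ℍ, B ≤ z.im →
      ‖(fun τ ↦ (P τ).coeff n) ((g₀ • z : ℍ) : ℂ)‖ ≤ M * Real.exp (π * (k * d : ℕ) * z.im) := by
    intro n g₀
    obtain ⟨B, M, h⟩ := hgrow g₀
    exact ⟨B, M, fun z hz ↦ h n z hz⟩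
  -- Laurent theorem for each coefficient
  have hLaurent : ∀ n, ∃ Q : ℂ[X], Q.natDegree ≤ 3 * (k * d) ∧ ∀ τ : ℂ, 0 < τ.im →
      (P τ).coeff n * (modularLambda τ ^ (k * d) * (1 - modularLambda τ) ^ (k * d)) =
        Q.eval (modularLambda τ) := fun n ↦
    exists_polynomial_of_Gamma_two_invariant_of_forall (k * d) (had n) (hainv n) (hgr n)
  choose Q hQdeg hQ using hLaurent
  -- the polynomial
  refine ⟨∑ n ∈ Finset.range d, C (Q n) * X ^ n + C ((X * (1 - X)) ^ (k * d)) * X ^ d,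
    ?_, ?_, ?_, ?_⟩
  · -- degree
    refine (natDegree_add_le _ _).trans (max_le ?_ ?_)
    · refine (natDegree_sum_le _ _).trans (Finset.sup_le fun n hn ↦ ?_)
      refine (natDegree_C_mul_X_pow_le _ _).trans (Finset.mem_range.mp hn).le
    · exact natDegree_C_mul_X_pow_le _ _
  · -- top coefficient
    rw [coeff_add, finsetSum_coeff, coeff_C_mul_X_pow, if_pos rfl,
      Finset.sum_eq_zero fun n hn ↦ ?_, zero_add]
    rw [coeff_C_mul_X_pow, if_neg (Finset.mem_range.mp hn).ne']
  · -- `X`-degrees of the coefficients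
    intro n
    rw [coeff_add, finsetSum_coeff]
    simp only [coeff_C_mul_X_pow]
    rw [Finset.sum_ite_eq]
    refine (natDegree_add_le _ _).trans (max_le ?_ ?_)
    · split_ifs
      · exact hQdeg n
      · simp
    · split_ifs
      · calc ((X * (1 - X) : ℂ[X]) ^ (k * d)).natDegree
            ≤ (k * d) * (X * (1 - X) : ℂ[X]).natDegree := natDegree_pow_le
          _ ≤ (k * d) * 2 := by
            refine Nat.mul_le_mul_left _ ((natDegree_mul_le).trans ?_)
            have h1 : (1 - X : ℂ[X]).natDegree ≤ 1 :=
              (natDegree_sub_le _ _).trans (by simp)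
            have h2 : (X : ℂ[X]).natDegree ≤ 1 := natDegree_X_le
            omega
          _ ≤ 3 * (k * d) := by omega
      · simp
  · -- the evaluation identity
    intro τ
    have hτ : 0 < (τ : ℂ).im := τ.im_pos
    apply Polynomial.ext
    intro n
    rw [Polynomial.coeff_map, coe_evalRingHom, coeff_add, finsetSum_coeff]
    simp only [coeff_C_mul_X_pow]
    rw [Finset.sum_ite_eq, coeff_C_mul, ← hPH τ]
    rcases lt_trichotomy n d with hn | rfl | hn
    · rw [if_pos (Finset.mem_range.mpr hn), if_neg hn.ne, eval_add, eval_zero, add_zero,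
        ← hQ n τ hτ, mul_pow]
      ring
    · rw [if_neg (by simp), if_pos rfl, eval_add, eval_zero, zero_add, eval_pow, eval_mul,
        eval_sub, eval_one, eval_X, hPtop, mul_one]
    · rw [if_neg (fun h ↦ by have := Finset.mem_range.mp h; omega), if_neg hn.ne', eval_add,
        eval_zero, zero_add, Polynomial.coeff_eq_zero_of_natDegree_lt (by rw [hPdeg]; exact hn),
        mul_zero]

/-! ### Uniqueness of the coefficients and the `S`-symmetry -/

/-- `λ(ℍ) = ℂ ∖ {0, 1}` is infinite. [folklore] -/
theorem infinite_setOf_modularLambda : Set.Infinite (Set.range fun τ : ℍ ↦ modularLambda τ) := by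
  rw [range_modularLambda]
  exact (Set.toFinite ({0, 1} : Set ℂ)).infinite_compl

/-- Two polynomials which agree at all values `λ(τ)`, `τ ∈ ℍ`, are equal. [folklore] -/
theorem polynomial_eq_of_eval_modularLambda_eq {p q : ℂ[X]}
    (h : ∀ τ : ℍ, p.eval (modularLambda τ) = q.eval (modularLambda τ)) : p = q := by
  refine Polynomial.eq_of_infinite_eval_eq p q (infinite_setOf_modularLambda.mono ?_)
  rintro _ ⟨τ, rfl⟩
  exact h τ

/-- **The coefficients of the orbit polynomial are determined by the orbit**: two polynomials in
`ℂ[X][Y]` with `𝒫(λ(τ), Y) = c(τ) ∏_{Φ ∈ O} (Y − Φ(τ))` for the same `c` and `O` are equal.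
[folklore] -/
theorem orbitPolynomial_eq_of_map_eq {P₁ P₂ : Polynomial ℂ[X]}
    (h : ∀ τ : ℍ, P₁.map (evalRingHom (modularLambda τ)) = P₂.map (evalRingHom (modularLambda τ))) :
    P₁ = P₂ := by
  apply Polynomial.ext
  intro n
  refine polynomial_eq_of_eval_modularLambda_eq fun τ ↦ ?_
  have := congrArg (fun p : ℂ[X] ↦ p.coeff n) (h τ)
  simpa [Polynomial.coeff_map] using this

/-- **`S`-symmetry of orbit polynomials.** If `Φ ↦ Φ ∘ S` maps the finite set `O` into `O'` and
`#O = #O'`, and `𝒫, 𝒫'` satisfy the orbit-polynomial identities for `O, O'` with the same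
exponent `M`, then `𝒫(1 − X, Y) = 𝒫'(X, Y)`, i.e. `(𝒫.coeff n)(1 − X) = 𝒫'.coeff n`
(`λ(S • τ) = 1 − λ(τ)`). [cite: CalegariDimitrovTang2025, Remark 59] -/
theorem orbitPolynomial_coeff_comp_one_sub {O O' : Finset (ℍ → ℂ)} {M : ℕ}
    {P₁ P₂ : Polynomial ℂ[X]}
    (hS : ∀ Φ ∈ O, (fun z ↦ Φ (ModularGroup.S • z)) ∈ O') (hcard : O.card = O'.card)
    (h₁ : ∀ τ : ℍ, P₁.map (evalRingHom (modularLambda τ)) =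
      C ((modularLambda τ * (1 - modularLambda τ)) ^ M) * ∏ Φ ∈ O, (X - C (Φ τ)))
    (h₂ : ∀ τ : ℍ, P₂.map (evalRingHom (modularLambda τ)) =
      C ((modularLambda τ * (1 - modularLambda τ)) ^ M) * ∏ Φ ∈ O', (X - C (Φ τ))) (n : ℕ) :
    (P₁.coeff n).comp (1 - X) = P₂.coeff n := by
  classical
  refine polynomial_eq_of_eval_modularLambda_eq fun τ ↦ ?_
  -- evaluate at `λ(τ) = 1 - λ(S • τ)`
  have hlam : modularLambda ((ModularGroup.S • τ : ℍ) : ℂ) = 1 - modularLambda τ :=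
    modularLambda_S_smul τ
  have hcomp : ((P₁.coeff n).comp (1 - X)).eval (modularLambda τ) =
      (P₁.coeff n).eval (modularLambda ((ModularGroup.S • τ : ℍ) : ℂ)) := by
    rw [eval_comp, eval_sub, eval_one, eval_X, hlam]
  rw [hcomp]
  have e₁ := congrArg (fun p : ℂ[X] ↦ p.coeff n) (h₁ (ModularGroup.S • τ))
  have e₂ := congrArg (fun p : ℂ[X] ↦ p.coeff n) (h₂ τ)
  simp only [Polynomial.coeff_map, coe_evalRingHom] at e₁ e₂
  rw [e₁, e₂, hlam]
  -- the leading factors agree and the products agree after reindexing along `Φ ↦ Φ ∘ S`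
  have hlead : ((1 - modularLambda τ) * (1 - (1 - modularLambda τ))) ^ M =
      (modularLambda τ * (1 - modularLambda τ)) ^ M := by ring
  have hinj : Set.InjOn (fun Φ : ℍ → ℂ ↦ fun w ↦ Φ (ModularGroup.S • w)) O :=
    fun Φ _ Ψ _ h ↦ comp_smul_injective ModularGroup.S h
  have himage : O.image (fun Φ : ℍ → ℂ ↦ fun w ↦ Φ (ModularGroup.S • w)) = O' := by
    apply Finset.eq_of_subset_of_card_le
    · intro Ψ hΨ
      rw [Finset.mem_image] at hΨ
      obtain ⟨Φ, hΦ, rfl⟩ := hΨ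
      exact hS Φ hΦ
    · rw [Finset.card_image_of_injOn hinj, hcard]
  have hprod : ∏ Φ ∈ O, (X - C (Φ (ModularGroup.S • τ))) = ∏ Φ ∈ O', (X - C (Φ τ)) := by
    rw [← himage, Finset.prod_image hinj]
  rw [hlead, hprod]

end ModularLambda

end Literature.NumberTheory.Automorphic
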